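import Literature.Probability.RandomPlanarGeometry.SAWTriangularPolygonUnrooting
import Literature.Probability.RandomPlanarGeometry.SAWTriangularPolygonClasses
import Literature.Probability.RandomPlanarGeometry.SAWWidePolygons
import Literature.Probability.RandomPlanarGeometry.SAWCount
import HarnessLib

/-!
# Closing brick walks as polygons: `brickLoopEdges` is an `IsPolygon` edge set; canonical traversals are translation-rigid

Topic `Literature/Probability/RandomPlanarGeometry` (lane «pcv-sawmu», LINE «TRI-MADRAS», glue for S4𝕋; continues
`SAWTriangularPolygonUnrooting.lean` (`TriPolygon.loops`), `SAWTriangularPolygonCount.lean` (`brickLoopEdges`,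
`eq_or_eq_brickRev_of_brickLoopEdges_eq`), `SAWTriangularPolygonClasses.lean` (`vertsOf_brickLoopEdges`, `vertsOf_shiftEdges`)
and `SAWCount.lean` (`Zd.walkOfFn`)).

Source.  N. Madras and G. Slade, *The Self-Avoiding Walk* (1993) [MadrasSlade1993], Definition 3.2.1 p. 62 (a polygon is the
edge set of a self-avoiding walk with adjacent endpoints together with the closing bond) and Definition 3.2.2 / eq. (3.2.1) p. 63
(`2N` rooted oriented traversals per polygon; one canonical representative per translation class — the `Q[N]` device of the
proof of Theorem 3.2.3, p. 64: "Then Q[N] has exactly q_N members").  This file supplies the two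
bookkeeping facts the join map of the LINE «TRI-MADRAS» needs: the edge set `brickLoopEdges n ω` of a closing brick walk
`ω ∈ loops n` is a polygon of the brick-wall graph in the sense of `IsPolygon` (the vocabulary of the cap rules
`SAWTriangularPolygonJoinCap.lean`), with `n + 1` edges; and two canonical traversals whose edge sets are TRANSLATES of each
other are equal (so a positioned polygon determines its class representative and its position).

## Contents (namespace `Literature.Probability.RandomPlanarGeometry.SAW.TriPolygon`)
* (private) `edges_walkOfFn` — the edge list of `Zd.walkOfFn`;
* **`isPolygon_brickLoopEdges`**, `card_brickLoopEdges_of_mem_loops` (`ω ∈ loops n`, `n ≥ 2`);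
* **`eq_of_shiftEdges_brickLoopEdges`** — `ω, ζ ∈ triPolygonReps n`, `shiftEdges z (brickLoopEdges n ω) = brickLoopEdges n ζ`
  `⇒ ω = ζ ∧ z = 0`.
-/

open Finset SimpleGraph Literature.Probability.LatticeModels Literature.Probability.Percolation
open Literature.Barriers.CriticalPhenomena.SupercriticalSAW (shiftEdges)
open Literature.Probability.Percolation.SiteGadgetSystem (vertsOf mem_vertsOf)

namespace Literature.Probability.RandomPlanarGeometry.SAW

namespace TriPolygon

variable {n : ℕ} {ω ζ : ℕ → Site 2}

/-- The edge list of `walkOfFn ω n`: `[s(ω 0, ω 1), …, s(ω (n−1), ω n)]` (private plumbing). [folklore] -/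
private theorem edges_walkOfFn {V : Type*} {G : SimpleGraph V} (ω : ℕ → V) (n : ℕ) (h : ∀ i < n, G.Adj (ω i) (ω (i + 1))) :
    (Zd.walkOfFn ω n h).edges = (List.range n).map fun i => s(ω i, ω (i + 1)) := by
  induction n generalizing ω with
  | zero => rfl
  | succ n ih =>
    rw [Zd.walkOfFn, Walk.edges_cons, ih, List.range_succ_eq_map, List.map_cons, List.map_map]
    rfl

/-- **A closing brick walk traces a polygon**: for `ω ∈ loops n` (`n ≥ 2`) the edge set `brickLoopEdges n ω` (the `n` bonds of `ω`
and the closing bond `{ω n, 0}`) is the edge set of a cycle of the brick-wall graph.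
[cite: MadrasSlade1993, Definition 3.2.1 (p. 62)] -/
theorem isPolygon_brickLoopEdges (hn : 2 ≤ n) (hω : ω ∈ loops n) : IsPolygon brickGraph (brickLoopEdges n ω) := by
  classical
  obtain ⟨hs, hlast⟩ := mem_loops.1 hω
  obtain ⟨h0, -, hadj, hinj⟩ := mem_brickSaws.1 hs
  set p : brickGraph.Walk 0 (ω n) := (Zd.walkOfFn ω n hadj).copy h0 rfl with hp
  have hpath : p.IsPath := by
    rw [← Walk.IsPath.getVert_injOn_iff]
    intro i hi j hj hij
    simp only [Set.mem_setOf_eq, hp, Walk.length_copy, Zd.length_walkOfFn] at hi hj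
    simp only [hp, Walk.getVert_copy, Zd.getVert_walkOfFn, min_eq_left hi, min_eq_left hj] at hij
    exact hinj hi hj hij
  have hedges : p.edges = (List.range n).map fun i => s(ω i, ω (i + 1)) := by
    rw [hp, Walk.edges_copy, edges_walkOfFn]
  have hnot : s(ω n, (0 : Site 2)) ∉ p.edges := by
    rw [hedges, List.mem_map]
    rintro ⟨i, hi, he⟩
    rw [List.mem_range] at hi
    rcases Sym2.eq_iff.1 he with ⟨h1, h2⟩ | ⟨h1, h2⟩
    · have := hinj (show i ∈ {i | i ≤ n} by simp; omega) (show n ∈ {i | i ≤ n} by simp) h1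
      omega
    · have := hinj (show i ∈ {i | i ≤ n} by simp; omega) (show 0 ∈ {i | i ≤ n} by simp) (h1.trans h0.symm)
      have := hinj (show i + 1 ∈ {i | i ≤ n} by simp; omega) (show n ∈ {i | i ≤ n} by simp) h2
      omega
  refine ⟨ω n, Walk.cons hlast p, (Walk.cons_isCycle_iff p hlast).2 ⟨hpath, hnot⟩, ?_⟩
  rw [Walk.edges_cons, List.toFinset_cons, hedges, brickLoopEdges]
  congr 1

/-- `brickLoopEdges n ω` has `n + 1` edges for `ω ∈ loops n`, `n ≥ 2`. [cite: MadrasSlade1993, Definition 3.2.1 (p. 62)] -/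
theorem card_brickLoopEdges_of_mem_loops (hn : 2 ≤ n) (hω : ω ∈ loops n) : #(brickLoopEdges n ω) = n + 1 := by
  classical
  obtain ⟨hs, hlast⟩ := mem_loops.1 hω
  obtain ⟨h0, -, hadj, hinj⟩ := mem_brickSaws.1 hs
  have hinj' : Set.InjOn (fun i => s(ω i, ω (i + 1))) ↑(range n) := by
    intro i hi j hj hij
    rw [Finset.coe_range, Set.mem_Iio] at hi hj
    rcases Sym2.eq_iff.1 hij with ⟨h1, -⟩ | ⟨h1, h2⟩
    · exact hinj (show i ∈ {i | i ≤ n} by simp; omega) (show j ∈ {i | i ≤ n} by simp; omega) h1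
    · have a := hinj (show i ∈ {i | i ≤ n} by simp; omega) (show j + 1 ∈ {i | i ≤ n} by simp; omega) h1
      have b := hinj (show i + 1 ∈ {i | i ≤ n} by simp; omega) (show j ∈ {i | i ≤ n} by simp; omega) h2
      omega
  have hnot : s(ω n, (0 : Site 2)) ∉ (range n).image fun i => s(ω i, ω (i + 1)) := by
    rw [Finset.mem_image]
    rintro ⟨i, hi, he⟩
    rw [Finset.mem_range] at hi
    rcases Sym2.eq_iff.1 he with ⟨h1, -⟩ | ⟨h1, h2⟩
    · have := hinj (show i ∈ {i | i ≤ n} by simp; omega) (show n ∈ {i | i ≤ n} by simp) h1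
      omega
    · have := hinj (show i ∈ {i | i ≤ n} by simp; omega) (show 0 ∈ {i | i ≤ n} by simp) (h1.trans h0.symm)
      have := hinj (show i + 1 ∈ {i | i ≤ n} by simp; omega) (show n ∈ {i | i ≤ n} by simp) h2
      omega
  rw [brickLoopEdges, Finset.card_insert_of_notMem hnot, Finset.card_image_of_injOn hinj', Finset.card_range]

/-- the vertex set of `brickLoopEdges n ω` is the set of sites of `ω` (restated for `loops`). [cite: MadrasSlade1993, Definition 3.2.1 (p. 62)] -/
theorem vertsOf_brickLoopEdges_of_mem_loops (hn : 1 ≤ n) (hω : ω ∈ loops n) :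
    vertsOf (brickLoopEdges n ω) = (range (n + 1)).image ω :=
  vertsOf_brickLoopEdges (mem_brickSaws.1 (mem_loops.1 hω).1).1 hn

/-- `loops n = brickAdjEnd n` (two names for the closing brick walks). [cite: MadrasSlade1993, §3.2, eq. (3.2.1)] -/
theorem mem_brickAdjEnd_of_mem_loops (hω : ω ∈ loops n) : ω ∈ brickAdjEnd n := by
  rw [mem_brickAdjEnd]; exact mem_loops.1 hω

/-- **Canonical traversals are translation-rigid**: if the edge set of a canonical traversal `ζ` is a translate of the edge set
of a canonical traversal `ω` (same `n ≥ 2`), then `ω = ζ` and the translation is `0`.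
[cite: MadrasSlade1993, Definition 3.2.2 and §3.2 eq. (3.2.1) (p. 63: one representative per class)] -/
theorem eq_of_shiftEdges_brickLoopEdges (hn : 2 ≤ n) (hω : ω ∈ triPolygonReps n) (hζ : ζ ∈ triPolygonReps n) {z : Site 2}
    (h : shiftEdges z (brickLoopEdges n ω) = brickLoopEdges n ζ) : ω = ζ ∧ z = 0 := by
  classical
  obtain ⟨hωs, hωa, hωl, hωo⟩ := mem_triPolygonReps.1 hω
  obtain ⟨hζs, hζa, hζl, hζo⟩ := mem_triPolygonReps.1 hζ
  obtain ⟨hω0, -, -, -⟩ := mem_brickSaws.1 hωs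
  obtain ⟨hζ0, -, -, -⟩ := mem_brickSaws.1 hζs
  have hn1 : 1 ≤ n := by omega
  -- vertex sets: `sites ω + z = sites ζ`
  have hV : ((range (n + 1)).image ω).image (fun x => x + z) = (range (n + 1)).image ζ := by
    rw [← vertsOf_brickLoopEdges hω0 hn1, ← vertsOf_shiftEdges, h, vertsOf_brickLoopEdges hζ0 hn1]
  -- `z = ω 0 + z` is a site of `ζ`, hence lexicographically `≥ 0`
  have hz1 : LexNonneg z := by
    have : z ∈ (range (n + 1)).image ζ := by
      rw [← hV, Finset.mem_image]
      exact ⟨0, Finset.mem_image.2 ⟨0, by simp, hω0⟩, by simp⟩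
    obtain ⟨i, hi, hiz⟩ := Finset.mem_image.1 this
    rw [← hiz]; exact hζl i (by simpa [Nat.lt_succ_iff] using hi)
  -- `0 = ζ 0 = ω i + z` for some `i`, hence `−z = ω i` is lexicographically `≥ 0`
  have hz2 : LexNonneg (-z) := by
    have : (0 : Site 2) ∈ ((range (n + 1)).image ω).image (fun x => x + z) := by
      rw [hV, Finset.mem_image]; exact ⟨0, by simp, hζ0⟩
    obtain ⟨x, hx, hxz⟩ := Finset.mem_image.1 this
    obtain ⟨i, hi, rfl⟩ := Finset.mem_image.1 hx
    have e : -z = ω i := by rw [← neg_eq_of_add_eq_zero_right hxz, neg_neg]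
    rw [e]; exact hωl i (by simpa [Nat.lt_succ_iff] using hi)
  have hz : z = 0 := by
    unfold LexNonneg at hz1 hz2
    simp only [Pi.neg_apply] at hz2
    funext k; fin_cases k <;> simp <;> omega
  subst hz
  rw [shiftEdges_zero] at h
  refine ⟨?_, rfl⟩
  rcases eq_or_eq_brickRev_of_brickLoopEdges_eq (mem_brickAdjEnd.2 ⟨hωs, hωa⟩) (mem_brickAdjEnd.2 ⟨hζs, hζa⟩) hn1 h.symm
    with e | e
  · exact e.symm
  · -- the reversed traversal has the opposite orientation: contradiction with canonicity
    exfalso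
    have e1 : ζ 1 = ω n := by rw [e, brickRev_of_pos ω le_rfl hn1]; congr 1
    have en : ζ n = ω 1 := by rw [e, brickRev_of_pos ω hn1 le_rfl]; congr 1; omega
    rw [e1, en] at hζo
    unfold LexLT at hωo hζo
    omega

end TriPolygon

end Literature.Probability.RandomPlanarGeometry.SAW
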